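/-
Copyright (c) 2026. Released under Apache 2.0 license as described in the file LICENSE.
Track B ∕ K2-LIT (cell `hodgecm-mathlib`, squad K2, ENGINE E1), crux h413 = `stmt-HodgeConjecture-24833`, route of record `HCCMUnconditional`.
Prover seat `hodgecm-mathlib-K2E3-p12` (g6).  Deal «BL-P1» (K2E1-plan (g5) 08:32:53Z), file P1a-loc: the LOCAL half of Bernstein–Lapid's principle of meromorphic continuation.
-/
import Literature.Analysis.OperatorTheory.AnalyticFredholm     -- ★ `differentiableOn_matrix_det` (Leibniz expansion; Reed–Simon VI.14 bricks)
import Mathlib.Analysis.Normed.Module.HahnBanach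
import Mathlib.Analysis.Analytic.IsolatedZeros
import Mathlib.Analysis.Analytic.Uniqueness
import Mathlib.Analysis.Complex.CauchyIntegral
import Mathlib.LinearAlgebra.Matrix.Adjugate
import Mathlib.LinearAlgebra.Matrix.Nondegenerate
import HarnessLib

/-!
# K2·E1 — `K2E1MeromorphicSolutionPrincipleLocal`: BERNSTEIN–LAPID'S PRINCIPLE OF MEROMORPHIC CONTINUATION, LOCAL HALF — near every point where uniqueness holds on
# some open set, an analytic system of linear equations of locally finite type has `f·v = u` with `f ≢ 0`, `u` holomorphic (Cramer on the finite-dimensional reduction)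

Track B ∕ K2-LIT, crux h413 = `stmt-HodgeConjecture-24833`, route of record `HCCMUnconditional`; cell `hodgecm-mathlib`, squad K2, ENGINE E1 (campaign EIS-R7-BL-SPH, RULING «RE-WIRE N=3»).
Prover seat `hodgecm-mathlib-K2E3-p12` (g6).  THEOREMS ONLY (no `def`, no `instance`, no notation, no named-fact hypothesis, no `sorry`); lane `--supports stmt-HodgeConjecture-24833 --as helper`
(count-neutral).  Closes no socket.  GENERIC functional analysis — no automorphic content.

THE MATHEMATICS [BernsteinLapid2019 = arXiv:1911.02342, §2.3 Definition + Theorem 2.3, Appendix §9 pp. 28–29].  One complex variable `s ∈ W ⊆ ℂ` (`W` open connected), unknowns `v` in a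
Banach space `𝓥`, ONE operator equation `A(s)v = c(s)` into a Banach space `𝓦` (`A`, `c` holomorphic; a finite system is one equation into the product), of FINITE TYPE on `W` in
column form: holomorphic `e_1, …, e_n : W → 𝓥` with `Sol(s) := {v ∣ A(s)v = c(s)} ⊆ span{e_j(s)}`.  ASSUME uniqueness (`Sol(s)` a singleton) on a non-empty open `O ⊆ W`.  THEN there are
holomorphic `f : W → ℂ`, `u : W → 𝓥` with `f ≢ 0` on `W` such that for EVERY `s ∈ W` with `f(s) ≠ 0`, `Sol(s) = {v(s)}` is a singleton and `f(s)·v(s) = u(s)`.  PROOF (B–L appendix, two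
simplifications): `s₁ ∈ W` of maximal rank `k = dim span{e_j(s₁)}`; an injective re-indexing `a : κ ↪ Fin n` of an independent spanning subfamily (Mathlib `exists_linearIndependent'`);
biorthogonal functionals `ν_i ∈ 𝓥'`, `ν_i(e_{a j}(s₁)) = δ_{ij}` (Hahn–Banach §1); `D₁(s) := det(ν_i(e_{a j}(s)))`, `D₁(s₁) = 1`; on `{D₁ ≠ 0}` the subfamily is independent hence (maximality)
spans `span{e_j(s)} ⊇ Sol(s)`.  Pick `s₂ ∈ O ∩ {D₁ ≠ 0}` (isolated zeros: `{D₁ ≠ 0}` meets every non-empty open subset of `W`); uniqueness at `s₂` + independence ⟹ the vectors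
`A(s₂)e_{a j}(s₂)` are independent in `𝓦`; biorthogonal `φ_i ∈ 𝓦'` (Hahn–Banach again — the `k` equations of B–L are CHOSEN, `D₂(s₂) = 1`); `D₂(s) := det(φ_i(A(s)e_{a j}(s)))`,
`w(s) := Cramer(D₂-matrix, (φ_i(c(s)))_i)` holomorphic.  KEY (analytic continuation on the connected `W`, after multiplying by `D₂` — no connectedness of `{D₂ ≠ 0}` needed):
`A(s)(Σ_j w_j(s)e_{a j}(s)) = D₂(s)·c(s)` on all of `W` (it holds on the open `O ∩ {D₁D₂ ≠ 0} ∋ s₂` by uniqueness).  Hence on `{D₁D₂ ≠ 0}`: `v(s) := D₂(s)⁻¹Σ_j w_j(s)e_{a j}(s)` solves, and any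
solution has coordinates `b` with `D₂-matrix·b = φ(c)` hence `b = D₂⁻¹w` — uniqueness; `f := D₁D₂`, `u := D₁·Σ_j w_j e_{a j}`.
§1 generic bricks: **`exists_dual_biorthogonal`** (Hahn–Banach biorthogonal system to a finite independent family), **`eventually_ne_zero_of_analyticOnNhd`** ∕ **`exists_mem_ne_zero_of_isOpen`**
(isolated zeros on a preconnected open set), **`differentiableOn_cramer`**.  §2 **`exists_local_meromorphic_solution`** — THE LOCAL CLAIM.  (The global theorem — clopen propagation on
connected `D`, `U := ⋃ {f ≠ 0}`, Mathlib `MeromorphicOn` — is file P1a `K2E1MeromorphicSolutionPrinciple`.)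
HONEST LABEL: HC_CM is proved only modulo the 7 printed citations (2 remaining named inputs: hLiu418 = `stmt-HodgeConjecture-24832`, h413 = `stmt-HodgeConjecture-24833`) until rung 0
closes; this file asserts no named fact and closes no socket.
References: [BernsteinLapid2019] arXiv:1911.02342 (JAMS, doi:10.1090/jams/1020) §2.3 Thm 2.3, §9 · [ReedSimonI1980] Thm. VI.12–VI.14 · [Rudin1991] Thm. 3.5 (Hahn–Banach).
-/

set_option autoImplicit false
-- the mandated namespace repeats the single-problem summit's segment (`HodgeConjecture.HodgeConjecture`)
set_option linter.dupNamespace false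

noncomputable section

open Filter Topology Set Submodule Module Matrix
open scoped BigOperators Classical
open Literature.Analysis.OperatorTheory (differentiableOn_matrix_det)

namespace Summit.HodgeConjecture.HodgeConjecture.Cruxes.H413.K2E1MeromorphicSolutionPrincipleLocal

/-! ## §1 Generic bricks: biorthogonal functionals, isolated zeros on a connected open set, holomorphy of Cramer vectors -/

/-- **Hahn–Banach biorthogonal system**: for a finite linearly independent family `x_j` in a complex normed space there are continuous functionals `φ_i` with `φ_i(x_j) = δ_{ij}`
(coordinate functionals of `Basis.span`, continuous on the finite-dimensional span, extended by Mathlib `exists_extension_norm_eq`). [cite: Rudin1991, Thm. 3.5] -/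
theorem exists_dual_biorthogonal {E : Type*} [NormedAddCommGroup E] [NormedSpace ℂ E] {κ : Type*} [Fintype κ] {x : κ → E} (hx : LinearIndependent ℂ x) :
    ∃ φ : κ → (E →L[ℂ] ℂ), ∀ i j, φ i (x j) = if i = j then 1 else 0 := by
  haveI : FiniteDimensional ℂ (span ℂ (Set.range x)) := FiniteDimensional.span_of_finite ℂ (Set.finite_range x)
  have hφ : ∀ i : κ, ∃ g : E →L[ℂ] ℂ, ∀ y : span ℂ (Set.range x), g y = LinearMap.toContinuousLinearMap ((Basis.span hx).coord i) y := fun i => by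
    obtain ⟨g, hg, -⟩ := exists_extension_norm_eq (span ℂ (Set.range x)) (LinearMap.toContinuousLinearMap ((Basis.span hx).coord i))
    exact ⟨g, hg⟩
  choose φ hφ using hφ
  refine ⟨φ, fun i j => ?_⟩
  rw [show x j = ((Basis.span hx j : span ℂ (Set.range x)) : E) by rw [Basis.span_apply], hφ i, LinearMap.coe_toContinuousLinearMap', Basis.coord_apply,
    Basis.repr_self, Finsupp.single_apply]
  simp only [eq_comm]

/-- **Isolated zeros on a preconnected set**: a function analytic on a preconnected `W` which does not vanish at one point of `W` is non-zero on a punctured neighbourhood of EVERY point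
of `W` (Mathlib `AnalyticAt.eventually_eq_zero_or_eventually_ne_zero` + the identity theorem). [cite: ReedSimonI1980, Thm. VI.14, proof] -/
theorem eventually_ne_zero_of_analyticOnNhd {W : Set ℂ} (hWc : IsPreconnected W) {f : ℂ → ℂ} (hf : AnalyticOnNhd ℂ f W) {s₁ : ℂ} (hs₁ : s₁ ∈ W) (hf₁ : f s₁ ≠ 0)
    {x : ℂ} (hx : x ∈ W) : ∀ᶠ z in 𝓝[≠] x, f z ≠ 0 := by
  rcases (hf x hx).eventually_eq_zero_or_eventually_ne_zero with h | h
  · exact absurd (hf.eqOn_zero_of_preconnected_of_eventuallyEq_zero hWc hx h hs₁) hf₁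
  · exact h

/-- … hence `{f ≠ 0}` meets every non-empty open subset of `W`. [cite: ReedSimonI1980, Thm. VI.14, proof] -/
theorem exists_mem_ne_zero_of_isOpen {W : Set ℂ} (hWc : IsPreconnected W) {f : ℂ → ℂ} (hf : AnalyticOnNhd ℂ f W) {s₁ : ℂ} (hs₁ : s₁ ∈ W) (hf₁ : f s₁ ≠ 0)
    {O : Set ℂ} (hO : IsOpen O) (hOW : O ⊆ W) (hOne : O.Nonempty) : ∃ s ∈ O, f s ≠ 0 := by
  obtain ⟨x, hx⟩ := hOne
  obtain ⟨z, hz, hzO⟩ := ((eventually_ne_zero_of_analyticOnNhd hWc hf hs₁ hf₁ (hOW hx)).and (mem_nhdsWithin_of_mem_nhds (hO.mem_nhds hx))).exists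
  exact ⟨z, hzO, hz⟩

/-- **Cramer vectors of holomorphic data are holomorphic**: if the entries of `M(s)` and `b(s)` are holomorphic on `W`, so is every coordinate of `cramer (M s) (b s)` (a determinant of a
matrix with holomorphic entries, ★ `differentiableOn_matrix_det`). [folklore] -/
theorem differentiableOn_cramer {κ : Type*} [Fintype κ] [DecidableEq κ] {M : ℂ → Matrix κ κ ℂ} {b : ℂ → κ → ℂ} {W : Set ℂ}
    (hM : ∀ i j, DifferentiableOn ℂ (fun s => M s i j) W) (hb : ∀ i, DifferentiableOn ℂ (fun s => b s i) W) (j : κ) :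
    DifferentiableOn ℂ (fun s => cramer (M s) (b s) j) W := by
  simp only [cramer_apply]
  refine differentiableOn_matrix_det fun i j' => ?_
  simp only [updateCol_apply]
  split_ifs
  · exact hb i
  · exact hM i j'

/-! ## §2 The local claim of the principle of meromorphic continuation -/

/-- **BERNSTEIN–LAPID, PRINCIPLE OF MEROMORPHIC CONTINUATION — LOCAL CLAIM** [BernsteinLapid2019, Thm 2.3, proof §9].  `W ⊆ ℂ` open preconnected; `A : W → 𝓛(𝓥, 𝓦)`, `c : W → 𝓦` holomorphic
(`𝓥`, `𝓦` complex Banach spaces); the equation `A(s)v = c(s)` of FINITE TYPE on `W` (holomorphic columns `e_j`, `j < n`, spanning a space containing every solution); uniqueness of the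
solution on a non-empty open `O ⊆ W`.  THEN: holomorphic `f : W → ℂ`, `u : W → 𝓥`, `f ≢ 0` on `W`, and for every `s ∈ W` with `f(s) ≠ 0` the solution set is a singleton `{v}` with `f(s)•v = u(s)`.
[cite: BernsteinLapid2019, Thm 2.3 and §9] [cite: ReedSimonI1980, Thm. VI.14] -/
theorem exists_local_meromorphic_solution {𝓥 𝓦 : Type*} [NormedAddCommGroup 𝓥] [NormedSpace ℂ 𝓥] [CompleteSpace 𝓥] [NormedAddCommGroup 𝓦] [NormedSpace ℂ 𝓦] [CompleteSpace 𝓦]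
    {W : Set ℂ} (hWo : IsOpen W) (hWc : IsPreconnected W) {A : ℂ → 𝓥 →L[ℂ] 𝓦} (hA : DifferentiableOn ℂ A W) {c : ℂ → 𝓦} (hc : DifferentiableOn ℂ c W)
    {n : ℕ} {e : Fin n → ℂ → 𝓥} (he : ∀ j, DifferentiableOn ℂ (e j) W) (hsol : ∀ s ∈ W, ∀ v : 𝓥, A s v = c s → v ∈ span ℂ (Set.range fun j => e j s))
    {O : Set ℂ} (hO : IsOpen O) (hOW : O ⊆ W) (hOne : O.Nonempty) (hOunq : ∀ s ∈ O, ∃! v : 𝓥, A s v = c s) :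
    ∃ (f : ℂ → ℂ) (u : ℂ → 𝓥), DifferentiableOn ℂ f W ∧ DifferentiableOn ℂ u W ∧ (∃ s ∈ W, f s ≠ 0) ∧
      ∀ s ∈ W, f s ≠ 0 → ∃ v : 𝓥, (∀ w : 𝓥, A s w = c s ↔ w = v) ∧ f s • v = u s := by
  -- ranks of the column spans and a point `s₁` of maximal rank
  obtain ⟨r, hr⟩ : ∃ r : ℂ → ℕ, r = fun s => finrank ℂ (span ℂ (Set.range fun j => e j s)) := ⟨_, rfl⟩
  have hrle : ∀ s, r s ≤ n := fun s => by
    rw [hr]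
    simpa [Set.finrank] using finrank_range_le_card (R := ℂ) (fun j => e j s)
  obtain ⟨s₀', hs₀'⟩ := hOne
  have hbdd : BddAbove (r '' W) := ⟨n, by rintro _ ⟨s, -, rfl⟩; exact hrle s⟩
  obtain ⟨s₁, hs₁W, hs₁⟩ : ∃ s₁ ∈ W, r s₁ = sSup (r '' W) := Nat.sSup_mem (⟨r s₀', s₀', hOW hs₀', rfl⟩ : (r '' W).Nonempty) hbdd
  have hmax : ∀ s ∈ W, r s ≤ r s₁ := fun s hs => hs₁ ▸ le_csSup hbdd ⟨s, hs, rfl⟩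
  -- an injective re-indexing of an independent spanning subfamily at `s₁`
  obtain ⟨κ, a, ha, hspan, hli⟩ := exists_linearIndependent' ℂ (fun j => e j s₁)
  haveI : Fintype κ := Fintype.ofInjective a ha
  have hli' : LinearIndependent ℂ (fun j : κ => e (a j) s₁) := hli
  have hcard : r s₁ = Fintype.card κ := by
    rw [hr]
    show finrank ℂ (span ℂ (Set.range fun j => e j s₁)) = Fintype.card κ
    rw [← hspan]
    exact finrank_span_eq_card hli
  -- biorthogonal functionals `ν_i` and the first determinant `D₁`
  obtain ⟨ν, hν⟩ := exists_dual_biorthogonal hli'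
  obtain ⟨M₁, hM₁⟩ : ∃ M₁ : ℂ → Matrix κ κ ℂ, M₁ = fun s => Matrix.of fun i j => ν i (e (a j) s) := ⟨_, rfl⟩
  have hM₁e : ∀ s i j, M₁ s i j = ν i (e (a j) s) := fun s i j => by rw [hM₁]; rfl
  have hM₁d : DifferentiableOn ℂ (fun s => (M₁ s).det) W :=
    differentiableOn_matrix_det fun i j => by simp_rw [hM₁e]; exact (ν i).differentiable.comp_differentiableOn (he (a j))
  have hM₁s₁ : M₁ s₁ = 1 := by
    ext i j
    rw [hM₁e, hν, Matrix.one_apply]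
  have hD₁s₁ : (M₁ s₁).det ≠ 0 := by rw [hM₁s₁, det_one]; exact one_ne_zero
  -- on `{D₁ ≠ 0}` the subfamily is independent and spans the full column span
  have hli_s : ∀ s, (M₁ s).det ≠ 0 → LinearIndependent ℂ (fun j : κ => e (a j) s) := by
    intro s hD
    rw [Fintype.linearIndependent_iff]
    intro g hg j
    have hmul : M₁ s *ᵥ g = 0 := by
      ext i
      have h := congrArg (ν i) hg
      rw [map_sum, map_zero] at h
      simp_rw [map_smul, smul_eq_mul] at h
      rw [Pi.zero_apply, ← h, mulVec, dotProduct]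
      exact Finset.sum_congr rfl fun j _ => by rw [hM₁e, mul_comm]
    exact congrFun (eq_zero_of_mulVec_eq_zero hD hmul) j
  have hspan_s : ∀ s ∈ W, (M₁ s).det ≠ 0 → span ℂ (Set.range fun j : κ => e (a j) s) = span ℂ (Set.range fun j => e j s) := by
    intro s hs hD
    haveI : FiniteDimensional ℂ (span ℂ (Set.range fun j => e j s)) := FiniteDimensional.span_of_finite ℂ (Set.finite_range _)
    have hle : span ℂ (Set.range fun j : κ => e (a j) s) ≤ span ℂ (Set.range fun j => e j s) :=
      span_mono (by rintro _ ⟨j, rfl⟩; exact ⟨a j, rfl⟩)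
    refine Submodule.eq_of_le_of_finrank_eq hle (le_antisymm (Submodule.finrank_mono hle) ?_)
    rw [finrank_span_eq_card (hli_s s hD), ← hcard]
    have h := hmax s hs
    rw [hr] at h ⊢
    exact h
  -- a point `s₂ ∈ O` with `D₁(s₂) ≠ 0`
  obtain ⟨s₂, hs₂O, hD₁s₂⟩ : ∃ s₂ ∈ O, (M₁ s₂).det ≠ 0 :=
    exists_mem_ne_zero_of_isOpen hWc (hM₁d.analyticOnNhd hWo) hs₁W hD₁s₁ hO hOW ⟨s₀', hs₀'⟩
  have hs₂W : s₂ ∈ W := hOW hs₂O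
  -- uniqueness at `s₂` ⟹ the vectors `A(s₂) e_{a j}(s₂)` are independent in `𝓦`
  obtain ⟨v₂, hv₂, hv₂u⟩ := hOunq s₂ hs₂O
  have hyli : LinearIndependent ℂ (fun j : κ => A s₂ (e (a j) s₂)) := by
    rw [Fintype.linearIndependent_iff]
    intro g hg j
    have h0 : A s₂ (∑ j, g j • e (a j) s₂) = 0 := by rw [map_sum]; simp_rw [map_smul]; exact hg
    have h1 : v₂ + ∑ j, g j • e (a j) s₂ = v₂ := hv₂u _ (by beta_reduce; rw [map_add, hv₂, h0, add_zero])
    have hz : ∑ j, g j • e (a j) s₂ = 0 := by simpa using h1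
    exact Fintype.linearIndependent_iff.1 (hli_s s₂ hD₁s₂) g hz j
  -- biorthogonal functionals `φ_i ∈ 𝓦'`, the second determinant `D₂` and the Cramer vector `w`
  obtain ⟨φ, hφ⟩ := exists_dual_biorthogonal hyli
  obtain ⟨M₂, hM₂⟩ : ∃ M₂ : ℂ → Matrix κ κ ℂ, M₂ = fun s => Matrix.of fun i j => φ i (A s (e (a j) s)) := ⟨_, rfl⟩
  have hM₂e : ∀ s i j, M₂ s i j = φ i (A s (e (a j) s)) := fun s i j => by rw [hM₂]; rfl
  obtain ⟨bv, hbv⟩ : ∃ bv : ℂ → κ → ℂ, bv = fun s i => φ i (c s) := ⟨_, rfl⟩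
  have hbve : ∀ s i, bv s i = φ i (c s) := fun s i => by rw [hbv]
  have hM₂d : ∀ i j, DifferentiableOn ℂ (fun s => M₂ s i j) W := fun i j => by
    simp_rw [hM₂e]; exact (φ i).differentiable.comp_differentiableOn (hA.clm_apply (he (a j)))
  have hD₂d : DifferentiableOn ℂ (fun s => (M₂ s).det) W := differentiableOn_matrix_det hM₂d
  have hbvd : ∀ i, DifferentiableOn ℂ (fun s => bv s i) W := fun i => by simp_rw [hbve]; exact (φ i).differentiable.comp_differentiableOn hc
  have hwd : ∀ j, DifferentiableOn ℂ (fun s => cramer (M₂ s) (bv s) j) W := differentiableOn_cramer hM₂d hbvd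
  have hM₂s₂ : M₂ s₂ = 1 := by
    ext i j
    rw [hM₂e, hφ, Matrix.one_apply]
  have hD₂s₂ : (M₂ s₂).det ≠ 0 := by rw [hM₂s₂, det_one]; exact one_ne_zero
  -- applying `φ_i` to a solution written in the subfamily's coordinates gives the `D₂`-system
  have hcoord : ∀ s (b : κ → ℂ), A s (∑ j, b j • e (a j) s) = c s → M₂ s *ᵥ b = bv s := by
    intro s b hb
    ext i
    have h := congrArg (φ i) hb
    rw [map_sum, map_sum] at h
    simp_rw [map_smul, smul_eq_mul] at h
    rw [hbve, ← h, mulVec, dotProduct]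
    exact Finset.sum_congr rfl fun j _ => by rw [hM₂e, mul_comm]
  have hcramer : ∀ s (b : κ → ℂ), (M₂ s).det ≠ 0 → M₂ s *ᵥ b = bv s → b = ((M₂ s).det)⁻¹ • cramer (M₂ s) (bv s) := by
    intro s b hD hb
    have h : M₂ s *ᵥ (b - ((M₂ s).det)⁻¹ • cramer (M₂ s) (bv s)) = 0 := by
      rw [mulVec_sub, mulVec_smul, mulVec_cramer, smul_smul, inv_mul_cancel₀ hD, one_smul, hb, sub_self]
    exact sub_eq_zero.1 (eq_zero_of_mulVec_eq_zero hD h)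
  -- KEY: `A(s)(Σ_j w_j(s) e_{a j}(s)) = D₂(s)•c(s)` on all of `W` by analytic continuation from the open set `O ∩ {D₁ ≠ 0} ∩ {D₂ ≠ 0} ∋ s₂`
  have hGd : DifferentiableOn ℂ (fun s => A s (∑ j, cramer (M₂ s) (bv s) j • e (a j) s) - (M₂ s).det • c s) W :=
    (hA.clm_apply (DifferentiableOn.fun_sum fun j _ => (hwd j).smul (he (a j)))).sub (hD₂d.smul hc)
  have hO' : IsOpen (O ∩ ((W ∩ (fun s => (M₁ s).det) ⁻¹' {z | z ≠ 0}) ∩ (W ∩ (fun s => (M₂ s).det) ⁻¹' {z | z ≠ 0}))) :=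
    hO.inter ((hM₁d.continuousOn.isOpen_inter_preimage hWo isOpen_ne).inter (hD₂d.continuousOn.isOpen_inter_preimage hWo isOpen_ne))
  have hGO : ∀ s ∈ O ∩ ((W ∩ (fun s => (M₁ s).det) ⁻¹' {z | z ≠ 0}) ∩ (W ∩ (fun s => (M₂ s).det) ⁻¹' {z | z ≠ 0})),
      A s (∑ j, cramer (M₂ s) (bv s) j • e (a j) s) - (M₂ s).det • c s = 0 := by
    rintro s ⟨hsO, ⟨hsW, hD₁⟩, ⟨-, hD₂⟩⟩
    obtain ⟨vs, hvs, -⟩ := hOunq s hsO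
    have hmem : vs ∈ span ℂ (Set.range fun j : κ => e (a j) s) := by rw [hspan_s s hsW hD₁]; exact hsol s hsW vs hvs
    obtain ⟨b, hb⟩ := (Submodule.mem_span_range_iff_exists_fun ℂ).1 hmem
    have hb' := hcramer s b hD₂ (hcoord s b (by rw [hb]; exact hvs))
    have hsum : ∑ j, cramer (M₂ s) (bv s) j • e (a j) s = (M₂ s).det • vs := by
      rw [← hb, Finset.smul_sum]
      refine Finset.sum_congr rfl fun j _ => ?_
      rw [hb', Pi.smul_apply, smul_eq_mul, smul_smul, mul_inv_cancel_left₀ hD₂]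
    rw [hsum, map_smul, hvs, sub_self]
  have hG : ∀ s ∈ W, A s (∑ j, cramer (M₂ s) (bv s) j • e (a j) s) = (M₂ s).det • c s := by
    have hev : (fun s => A s (∑ j, cramer (M₂ s) (bv s) j • e (a j) s) - (M₂ s).det • c s) =ᶠ[𝓝 s₂] 0 :=
      eventually_of_mem (hO'.mem_nhds ⟨hs₂O, ⟨hs₂W, hD₁s₂⟩, ⟨hs₂W, hD₂s₂⟩⟩) hGO
    have h := (hGd.analyticOnNhd hWo).eqOn_zero_of_preconnected_of_eventuallyEq_zero hWc hs₂W hev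
    intro s hs
    exact sub_eq_zero.1 (h hs)
  -- `f := D₁·D₂`, `u := D₁ • Σ_j w_j e_{a j}`
  refine ⟨fun s => (M₁ s).det * (M₂ s).det, fun s => (M₁ s).det • ∑ j, cramer (M₂ s) (bv s) j • e (a j) s, hM₁d.mul hD₂d,
    hM₁d.smul (DifferentiableOn.fun_sum fun j _ => (hwd j).smul (he (a j))), ⟨s₂, hs₂W, mul_ne_zero hD₁s₂ hD₂s₂⟩, fun s hs hf => ?_⟩
  have hD₁ : (M₁ s).det ≠ 0 := left_ne_zero_of_mul hf
  have hD₂ : (M₂ s).det ≠ 0 := right_ne_zero_of_mul hf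
  refine ⟨((M₂ s).det)⁻¹ • ∑ j, cramer (M₂ s) (bv s) j • e (a j) s, fun w' => ⟨fun hw' => ?_, fun h => ?_⟩, ?_⟩
  · -- uniqueness: the coordinates of any solution solve the `D₂`-system
    have hmem : w' ∈ span ℂ (Set.range fun j : κ => e (a j) s) := by rw [hspan_s s hs hD₁]; exact hsol s hs w' hw'
    obtain ⟨b, hb⟩ := (Submodule.mem_span_range_iff_exists_fun ℂ).1 hmem
    have hb' := hcramer s b hD₂ (hcoord s b (by rw [hb]; exact hw'))
    rw [← hb, Finset.smul_sum]
    refine Finset.sum_congr rfl fun j _ => ?_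
    rw [hb', Pi.smul_apply, smul_eq_mul, smul_smul]
  · -- existence: the Cramer vector solves
    rw [h, map_smul, hG s hs, smul_smul, inv_mul_cancel₀ hD₂, one_smul]
  · rw [smul_smul, mul_assoc, mul_inv_cancel₀ hD₂, mul_one]

end Summit.HodgeConjecture.HodgeConjecture.Cruxes.H413.K2E1MeromorphicSolutionPrincipleLocal

end
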